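import Summits.ValiantsHypothesis.ValiantsHypothesis.Theses.FermionizationDimension
import Summits.ValiantsHypothesis.ValiantsHypothesis.Theorems.HubHub
import Literature.Computability.AlgebraicComplexity.ValiantClasses
import Literature.Computability.AlgebraicComplexity.ValiantConjectureProofs

/-!
# Route `FermionizationDimension` — assembly (item stmt-ValiantsHypothesis-7293)

`Assembly := SDimPerNotQP → ClassTransfer → ValiantsHypothesis`.

Pure bookkeeping over proved tree facts.  The permanent family `n ↦ per_n ∈ ℂ[x_ij]` is, on the
nose, the generalized-matrix-function family of the class function `χ ≡ 1`
(`∑_σ C 1 · ∏_i X (σ i, i) = per_n`, `gmfFamily_one_eq_perFamily`).  So if `per` were a `VP_ℂ`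
family, `ClassTransfer` (at `χ ≡ 1`, trivially conjugation invariant) would give a
quasi-polynomially bounded `s` and, for EVERY `n`, a commutative finite-dimensional `ℂ`-algebra `R`
with `finrank R ≤ s n`, `u ∈ R^{n×n}`, `ℓ ∈ R^*` realising `ℓ (∏ u_{σ i, i}) = sgn σ · 1 = sgn σ`;
`SDimPerNotQP` at this `s` yields an `n` at which every such realisation has `s n < finrank R` —
contradiction (`not_isVPFamily_per_of_sDimPerNotQP_of_classTransfer`).  Hence `per ∉ VP_ℂ`, and the
hub lemma `Summit.ValiantsHypothesis.Hub.valiantsHypothesis_of_not_isVPFamily_per` with the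
renaming bridge `mem_VP_ofFintype_iff_holds` and Valiant's theorem `perFamily_mem_VNP_holds ℂ`
(`per ∈ VNP`) gives `VP ℂ ≠ VNP ℂ`.  Unconditional (no named-fact hypotheses).
-/

namespace Summit.ValiantsHypothesis.Theorems.FermionizationDimension

open Literature.Computability.AlgebraicComplexity
open Summit.ValiantsHypothesis.ValiantsHypothesis.Theses.FermionizationDimension

/-- The generalized-matrix-function family of the constant class function `χ ≡ 1`,
`n ↦ ∑_σ C 1 · ∏_i X (σ i, i)`, is the permanent family `n ↦ per_n` over `ℂ`. [folklore] -/
theorem gmfFamily_one_eq_perFamily :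
    (fun n => ∑ σ : Equiv.Perm (Fin n),
      MvPolynomial.C ((fun (m : ℕ) (_ : Equiv.Perm (Fin m)) => (1 : ℂ)) n σ) *
        ∏ i : Fin n, MvPolynomial.X (σ i, i)) =
      (fun n => perPoly (Fin n) ℂ) := by
  funext n
  simp [perPoly, Matrix.permanent, Matrix.mvPolynomialX]

/-- **`per ∉ VP_ℂ` from the two cruxes.** If the commutative twisting dimension of the permanent
is not quasi-polynomially bounded (`SDimPerNotQP`) and every `VP_ℂ` class-function family has a
quasi-polynomially bounded commutative realisation of `sgn · χ` (`ClassTransfer`), then the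
permanent family is not a `VP_ℂ` family: apply `ClassTransfer` to `χ ≡ 1` (whose GMF family is
`per`), obtaining a qp-bounded `s` with realisations of `sgn` of dimension `≤ s n` for all `n`, and
contradict `SDimPerNotQP` at its witness `n`. [folklore] -/
theorem not_isVPFamily_per_of_sDimPerNotQP_of_classTransfer
    (h1 : SDimPerNotQP) (h2 : ClassTransfer) :
    ¬ IsVPFamily (k := ℂ) (fun n => perPoly (Fin n) ℂ) := by
  intro hper
  have hfam : IsVPFamily (k := ℂ)
      (fun n => ∑ σ : Equiv.Perm (Fin n),
        MvPolynomial.C ((fun (m : ℕ) (_ : Equiv.Perm (Fin m)) => (1 : ℂ)) n σ) *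
          ∏ i : Fin n, MvPolynomial.X (σ i, i)) := by
    rw [gmfFamily_one_eq_perFamily]; exact hper
  obtain ⟨s, hs, hreal⟩ :=
    h2 (fun (m : ℕ) (_ : Equiv.Perm (Fin m)) => (1 : ℂ)) (fun _ _ _ _ => rfl) hfam
  obtain ⟨n, hn⟩ := h1 s hs
  obtain ⟨R, _, _, _, u, ℓ, hdim, hu⟩ := hreal n
  have hlt : s n < Module.finrank ℂ R := hn R u ℓ (fun σ => by rw [hu σ, mul_one])
  omega

/-- **Settles item stmt-ValiantsHypothesis-7293** (assembly of route `FermionizationDimension`):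
`SDimPerNotQP → ClassTransfer → ValiantsHypothesis` — `per ∉ VP_ℂ` by
`not_isVPFamily_per_of_sDimPerNotQP_of_classTransfer`, then the hub lemma
`Hub.valiantsHypothesis_of_not_isVPFamily_per` with the renaming bridge
`mem_VP_ofFintype_iff_holds` and `perFamily_mem_VNP_holds ℂ` (Valiant 1979). [folklore] -/
theorem assembly_proof :
    Summit.ValiantsHypothesis.ValiantsHypothesis.Theses.FermionizationDimension.Assembly := by
  unfold Summit.ValiantsHypothesis.ValiantsHypothesis.Theses.FermionizationDimension.Assembly
  intro h1 h2
  exact Summit.ValiantsHypothesis.Hub.valiantsHypothesis_of_not_isVPFamily_per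
    (not_isVPFamily_per_of_sDimPerNotQP_of_classTransfer h1 h2)
    (mem_VP_ofFintype_iff_holds _) (perFamily_mem_VNP_holds ℂ)

end Summit.ValiantsHypothesis.Theorems.FermionizationDimension
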